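import Mathlib
import Literature.Analysis.FluidPDE.Tao2016AveragedNS.ShiftSetCascadeFlows
import Summits.NavierStokesRegularity.NavierStokesRegularity.Theorems.TaoLadderRungTwoFlatQuadPolarOn
import HarnessLib

/-!
# Amplitude/time scaling covariance of shift-set pseudo-flows (theory-1 g49 numT64, design W-29; cure (α) of TRAP #25)

The quadratic lattice `X' = Q(X)` on a shift set `𝕊` is covariant under `X(t) ↦ x·X(x·t)` (`Q(xX) = x²Q(X)`, `Q` pointwise
in time).  For the restarted pseudo-flows `PseudoFlowOnShift` (displays (4.5), (4.8)–(4.10) with defect constants `κ₁, κ₂` and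
(4.10)-slack `B₀`) the scaled pair `(x·S(x·), x²·F(x·))` is again a pseudo-flow, on the horizon `τ'` with `x·τ' ≤ τ`, with defect
constants `x·κ₁, x·κ₂` and slack `x²·B₀` (`pseudoFlowOnShift_scale`); defect constants and slack are monotone parameters
(`pseudoFlowOnShift_mono_defect`); hence for an anchor ratio `x ∈ (0, 1]` the CO-SCALED REFERENCE `W_x(t) = x·W(x·t)` of a reference
pseudo-flow `W` on `[0, c_W] ⊇ [0, c₀]` is a reference pseudo-flow on `[0, c₀]` with the SAME constants (`pseudoFlowOnShift_coScaled`),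
its sup bounds on `[0, c₀]` are inherited (`abs_coScaled_le`), and its start state is `x·W₀` — so that, with `W₀ = u⋆` and
`x = anchorScale z`, the start mismatch `anchorScale z · u⋆ − (W_x)₀` at every shell is identically zero (`coScaled_start_sub_eq_zero`).

USE (cell harvest/h2-tao-ladder, LADDER §64.8 TRAP #25): in the near/behind hop step and the interface loop the reference flow is
fixed outside `∀ z` while the anchor clause admits ratios `x ∈ [1 − γ, 1]`; measuring deviations from `W_{x_z}` instead removes the
`γ·|u⋆|` floors (`hE₁`/`hEW` become `0`) at no cost in the schedule constants.

HONEST FRAMING: elementary calculus over the Literature structure `PseudoFlowOnShift` (MODEL lattice vocabulary); nothing certified;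
no item closed; nothing about the Navier–Stokes equations.
-/

noncomputable section

-- the sub-problem namespace repeats the summit name by design (D-0017)
set_option linter.dupNamespace false

namespace Summit.NavierStokesRegularity.NavierStokesRegularity.Theorems

open Set Literature.Analysis.FluidPDE Literature.Analysis.FluidPDE.TaoCascade intervalIntegral

namespace QuadPolar

variable {m : ℕ}

/-- `Q` is pointwise in time: evaluating the time-rescaled family is evaluating `Q` at the rescaled time.
[cite: Tao2016AveragedNS, §4 (4.8)] -/
theorem quadTermOn_timeScale (𝕊 : Finset (ℤ × ℤ × ℤ)) (ε₀ x : ℝ)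
    (α : Fin m → Fin m → Fin m → ℤ × ℤ × ℤ → ℝ) (X : Fin m → ℤ → ℝ → ℝ) (i : Fin m) (n : ℤ) (t : ℝ) :
    quadTermOn 𝕊 ε₀ α (fun j k s => X j k (x * s)) i n t = quadTermOn 𝕊 ε₀ α X i n (x * t) := by
  simp only [quadTermOn]

/-- **`Q(x·X(x·)) (t) = x²·Q(X)(x·t)`** (amplitude/time scaling covariance of the quadratic lattice).
[cite: Tao2016AveragedNS, §4 (4.8)] -/
theorem quadTermOn_scale (𝕊 : Finset (ℤ × ℤ × ℤ)) (ε₀ x : ℝ)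
    (α : Fin m → Fin m → Fin m → ℤ × ℤ × ℤ → ℝ) (X : Fin m → ℤ → ℝ → ℝ) (i : Fin m) (n : ℤ) (t : ℝ) :
    quadTermOn 𝕊 ε₀ α (fun j k s => x * X j k (x * s)) i n t = x ^ 2 * quadTermOn 𝕊 ε₀ α X i n (x * t) := by
  have hfun : (fun j k s => x * X j k (x * s)) = x • (fun j k s => X j k (x * s)) := by
    funext j k s
    simp [Pi.smul_apply, smul_eq_mul]
  rw [hfun, quadTermOn_smul, quadTermOn_timeScale]

/-- **Scaling covariance of shift-set pseudo-flows**: if `(S, F)` is a pseudo-flow on `[0, τ]` with defect constants `κ₁, κ₂`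
and slack `B₀`, then for `x > 0` and a horizon `τ' > 0` with `x·τ' ≤ τ` the pair `(t ↦ x·S(x t), t ↦ x²·F(x t))` is a pseudo-flow
on `[0, τ']` from `(x·S₀, x²·F₀)` with defect constants `x·κ₁, x·κ₂` and slack `x²·B₀`.
[cite: Tao2016AveragedNS, §4 Lemma 4.1 (4.5), (4.8)–(4.10) (the displays are homogeneous under the scaling); cell LADDER §64.8 (TRAP #25, cure α)] -/
theorem pseudoFlowOnShift_scale {𝕊 : Finset (ℤ × ℤ × ℤ)} {τ τ' ε₀ x : ℝ}
    {α : Fin m → Fin m → Fin m → ℤ × ℤ × ℤ → ℝ} {κ₁ κ₂ : ℝ} {S₀ F₀ B₀ : Fin m → ℤ → ℝ}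
    {S F : Fin m → ℤ → ℝ → ℝ} (h : PseudoFlowOnShift 𝕊 τ ε₀ α κ₁ κ₂ S₀ F₀ B₀ S F)
    (hx : 0 < x) (hτ' : 0 < τ') (hxτ : x * τ' ≤ τ) :
    PseudoFlowOnShift 𝕊 τ' ε₀ α (x * κ₁) (x * κ₂) (fun i k => x * S₀ i k) (fun i k => x ^ 2 * F₀ i k)
      (fun i k => x ^ 2 * B₀ i k) (fun i k t => x * S i k (x * t)) (fun i k t => x ^ 2 * F i k (x * t)) := by
  -- the affine time change maps the new window into the old one
  have hmaps : MapsTo (fun t : ℝ => x * t) (Icc 0 τ') (Icc 0 τ) := by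
    intro t ht
    exact ⟨mul_nonneg hx.le ht.1, (mul_le_mul_of_nonneg_left ht.2 hx.le).trans hxτ⟩
  have hmem : ∀ s ∈ Icc (0 : ℝ) τ', x * s ∈ Icc (0 : ℝ) τ := fun s hs => hmaps hs
  have hlin : ∀ s, HasDerivWithinAt (fun t : ℝ => x * t) x (Icc 0 τ') s := fun s => by
    have h1 := (hasDerivWithinAt_id s (Icc 0 τ')).const_mul x
    simp only [id_eq, mul_one] at h1
    exact h1
  have hlinC : ContDiffOn ℝ 1 (fun t : ℝ => x * t) (Icc 0 τ') := (contDiffOn_const.mul contDiffOn_id)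
  -- derivatives of the scaled amplitudes / energies inside the new window
  have hdS : ∀ i k, ∀ s ∈ Icc (0 : ℝ) τ',
      derivWithin (fun t => x * S i k (x * t)) (Icc 0 τ') s = x ^ 2 * derivWithin (S i k) (Icc 0 τ) (x * s) := by
    intro i k s hs
    have hS : HasDerivWithinAt (S i k) (derivWithin (S i k) (Icc 0 τ) (x * s)) (Icc 0 τ) (x * s) :=
      ((h.contDiffOn_S i k).differentiableOn (by norm_num) (x * s) (hmem s hs)).hasDerivWithinAt
    have hcomp : HasDerivWithinAt (fun t => S i k (x * t)) (derivWithin (S i k) (Icc 0 τ) (x * s) * x) (Icc 0 τ') s :=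
      hS.comp s (hlin s) hmaps
    have hmul := hcomp.const_mul x
    rw [hmul.derivWithin (uniqueDiffOn_Icc hτ' s hs)]
    ring
  have hdF : ∀ i k, ∀ s ∈ Icc (0 : ℝ) τ',
      derivWithin (fun t => x ^ 2 * F i k (x * t)) (Icc 0 τ') s = x ^ 3 * derivWithin (F i k) (Icc 0 τ) (x * s) := by
    intro i k s hs
    have hF : HasDerivWithinAt (F i k) (derivWithin (F i k) (Icc 0 τ) (x * s)) (Icc 0 τ) (x * s) :=
      ((h.contDiffOn_F i k).differentiableOn (by norm_num) (x * s) (hmem s hs)).hasDerivWithinAt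
    have hcomp : HasDerivWithinAt (fun t => F i k (x * t)) (derivWithin (F i k) (Icc 0 τ) (x * s) * x) (Icc 0 τ') s :=
      hF.comp s (hlin s) hmaps
    have hmul := hcomp.const_mul (x ^ 2)
    rw [hmul.derivWithin (uniqueDiffOn_Icc hτ' s hs)]
    ring
  have hsqrt : ∀ i k s, s ∈ Icc (0 : ℝ) τ' → Real.sqrt (x ^ 2 * F i k (x * s)) = x * Real.sqrt (F i k (x * s)) := by
    intro i k s hs
    rw [Real.sqrt_mul (by positivity), Real.sqrt_sq hx.le]
  -- the substitution `u = x u'` in the (4.10) slack integral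
  have hint : ∀ i k (s : ℝ), ∫ u in (0 : ℝ)..s, x ^ 2 * F i k (x * u) = x * ∫ u in (0 : ℝ)..(x * s), F i k u := by
    intro i k s
    have hsub : x * ∫ u in (0 : ℝ)..s, F i k (x * u) = ∫ u in (0 : ℝ)..(x * s), F i k u := by
      have := intervalIntegral.smul_integral_comp_mul_left (F i k) x (a := 0) (b := s)
      rw [smul_eq_mul, mul_zero] at this
      exact this
    rw [intervalIntegral.integral_const_mul, ← hsub]
    ring
  refine
    { contDiffOn_S := ?_, contDiffOn_F := ?_, nonneg_F := ?_, apriori_S := ?_, apriori_F := ?_, init_S := ?_,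
      init_F := ?_, motion := ?_, energy := ?_, defect_lower := ?_, defect_upper := ?_ }
  · intro i k
    exact contDiffOn_const.mul ((h.contDiffOn_S i k).comp hlinC hmaps)
  · intro i k
    exact contDiffOn_const.mul ((h.contDiffOn_F i k).comp hlinC hmaps)
  · intro i k s hs
    exact mul_nonneg (by positivity) (h.nonneg_F i k (x * s) (hmem s hs))
  · obtain ⟨M, hM⟩ := h.apriori_S
    refine ⟨x * M, fun s hs i k => ?_⟩
    have hb := hM (x * s) (hmem s hs) i k
    calc (1 + (1 + ε₀) ^ ((10 : ℝ) * k)) * |x * S i k (x * s)|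
        = x * ((1 + (1 + ε₀) ^ ((10 : ℝ) * k)) * |S i k (x * s)|) := by
          rw [abs_mul, abs_of_pos hx]; ring
      _ ≤ x * M := mul_le_mul_of_nonneg_left hb hx.le
  · obtain ⟨M, hM⟩ := h.apriori_F
    refine ⟨x * M, fun s hs i k => ?_⟩
    have hb := hM (x * s) (hmem s hs) i k
    calc (1 + (1 + ε₀) ^ ((10 : ℝ) * k)) * Real.sqrt (x ^ 2 * F i k (x * s))
        = x * ((1 + (1 + ε₀) ^ ((10 : ℝ) * k)) * Real.sqrt (F i k (x * s))) := by
          rw [hsqrt i k s hs]; ring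
      _ ≤ x * M := mul_le_mul_of_nonneg_left hb hx.le
  · intro i k
    simp [h.init_S i k]
  · intro i k
    simp [h.init_F i k]
  · -- (4.8): |x² S'(xs) − x² Q(S)(xs)| = x² |S' − Q| ≤ x² κ₁ w √F = (x κ₁) w √(x² F)
    intro i k s hs
    have hmot := h.motion i k (x * s) (hmem s hs)
    rw [hdS i k s hs, quadTermOn_scale, hsqrt i k s hs, ← mul_sub, abs_mul, abs_of_pos (by positivity : (0 : ℝ) < x ^ 2)]
    calc x ^ 2 * |derivWithin (S i k) (Icc 0 τ) (x * s) - quadTermOn 𝕊 ε₀ α S i k (x * s)|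
        ≤ x ^ 2 * (κ₁ * (1 + ε₀) ^ ((2 : ℝ) * k) * Real.sqrt (F i k (x * s))) :=
          mul_le_mul_of_nonneg_left hmot (by positivity)
      _ = x * κ₁ * (1 + ε₀) ^ ((2 : ℝ) * k) * (x * Real.sqrt (F i k (x * s))) := by ring
  · -- (4.9): x³ F'(xs) ≤ x³ Q S = Q(S_x) S_x
    intro i k s hs
    have hen := h.energy i k (x * s) (hmem s hs)
    rw [hdF i k s hs, quadTermOn_scale]
    calc x ^ 3 * derivWithin (F i k) (Icc 0 τ) (x * s)
        ≤ x ^ 3 * (quadTermOn 𝕊 ε₀ α S i k (x * s) * S i k (x * s)) := mul_le_mul_of_nonneg_left hen (by positivity)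
      _ = x ^ 2 * quadTermOn 𝕊 ε₀ α S i k (x * s) * (x * S i k (x * s)) := by ring
  · -- (4.10) lower
    intro i k s hs
    have hlo := h.defect_lower i k (x * s) (hmem s hs)
    calc 1 / 2 * (x * S i k (x * s)) ^ 2 = x ^ 2 * (1 / 2 * S i k (x * s) ^ 2) := by ring
      _ ≤ x ^ 2 * F i k (x * s) := mul_le_mul_of_nonneg_left hlo (by positivity)
  · -- (4.10) upper: the slack integral substitutes `u = x u'`
    intro i k s hs
    have hup := h.defect_upper i k (x * s) (hmem s hs)
    rw [hint i k s]
    calc x ^ 2 * F i k (x * s)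
        ≤ x ^ 2 * (1 / 2 * S i k (x * s) ^ 2 + B₀ i k
            + κ₂ * (1 + ε₀) ^ ((2 : ℝ) * k) * ∫ u in (0 : ℝ)..(x * s), F i k u) := mul_le_mul_of_nonneg_left hup (by positivity)
      _ = 1 / 2 * (x * S i k (x * s)) ^ 2 + x ^ 2 * B₀ i k
            + x * κ₂ * (1 + ε₀) ^ ((2 : ℝ) * k) * (x * ∫ u in (0 : ℝ)..(x * s), F i k u) := by ring


/-- **Defect constants and slack are monotone parameters** of `PseudoFlowOnShift`.
[cite: Tao2016AveragedNS, §4 Lemma 4.1 (4.8), (4.10) (statement shape)] -/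
theorem pseudoFlowOnShift_mono_defect {𝕊 : Finset (ℤ × ℤ × ℤ)} {τ ε₀ : ℝ}
    {α : Fin m → Fin m → Fin m → ℤ × ℤ × ℤ → ℝ} {κ₁ κ₂ κ₁' κ₂' : ℝ} {S₀ F₀ B₀ B₀' : Fin m → ℤ → ℝ}
    {S F : Fin m → ℤ → ℝ → ℝ} (h : PseudoFlowOnShift 𝕊 τ ε₀ α κ₁ κ₂ S₀ F₀ B₀ S F)
    (hε : 0 ≤ 1 + ε₀) (h₁ : κ₁ ≤ κ₁') (h₂ : κ₂ ≤ κ₂') (hB : ∀ i k, B₀ i k ≤ B₀' i k) :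
    PseudoFlowOnShift 𝕊 τ ε₀ α κ₁' κ₂' S₀ F₀ B₀' S F where
  contDiffOn_S := h.contDiffOn_S
  contDiffOn_F := h.contDiffOn_F
  nonneg_F := h.nonneg_F
  apriori_S := h.apriori_S
  apriori_F := h.apriori_F
  init_S := h.init_S
  init_F := h.init_F
  motion i k s hs := by
    have hw : 0 ≤ (1 + ε₀) ^ ((2 : ℝ) * k) * Real.sqrt (F i k s) :=
      mul_nonneg (Real.rpow_nonneg hε _) (Real.sqrt_nonneg _)
    calc |derivWithin (S i k) (Icc 0 τ) s - quadTermOn 𝕊 ε₀ α S i k s|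
        ≤ κ₁ * (1 + ε₀) ^ ((2 : ℝ) * k) * Real.sqrt (F i k s) := h.motion i k s hs
      _ = κ₁ * ((1 + ε₀) ^ ((2 : ℝ) * k) * Real.sqrt (F i k s)) := by ring
      _ ≤ κ₁' * ((1 + ε₀) ^ ((2 : ℝ) * k) * Real.sqrt (F i k s)) := mul_le_mul_of_nonneg_right h₁ hw
      _ = κ₁' * (1 + ε₀) ^ ((2 : ℝ) * k) * Real.sqrt (F i k s) := by ring
  energy := h.energy
  defect_lower := h.defect_lower
  defect_upper i k s hs := by
    have hI : 0 ≤ ∫ u in (0 : ℝ)..s, F i k u :=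
      intervalIntegral.integral_nonneg hs.1 fun u hu => h.nonneg_F i k u ⟨hu.1, hu.2.trans hs.2⟩
    have hw : 0 ≤ (1 + ε₀) ^ ((2 : ℝ) * k) * ∫ u in (0 : ℝ)..s, F i k u :=
      mul_nonneg (Real.rpow_nonneg hε _) hI
    calc F i k s ≤ 1 / 2 * S i k s ^ 2 + B₀ i k + κ₂ * (1 + ε₀) ^ ((2 : ℝ) * k) * ∫ u in (0 : ℝ)..s, F i k u :=
          h.defect_upper i k s hs
      _ ≤ 1 / 2 * S i k s ^ 2 + B₀' i k + κ₂' * (1 + ε₀) ^ ((2 : ℝ) * k) * ∫ u in (0 : ℝ)..s, F i k u := by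
          have := mul_le_mul_of_nonneg_right h₂ hw
          nlinarith [hB i k, this]

/-- **The co-scaled reference flow** (cure (α) of TRAP #25): for a reference pseudo-flow `W` on `[0, c_W]` with `κ₁ = 0`,
`κ₂ ≥ 0`, slack `B_W ≥ 0`, and an anchor ratio `x ∈ (0, 1]`, the family `W_x(t) = x·W(x t)` (with energies `x²·F_W(x t)`) is a
reference pseudo-flow on `[0, c₀]`, `0 < c₀ ≤ c_W`, from `x·W₀` with the SAME constants `0, κ₂, B_W`.
[cite: Tao2016AveragedNS, §4 Lemma 4.1 (4.5), (4.8)–(4.10); cell LADDER §64.8 (TRAP #25, cure α)] -/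
theorem pseudoFlowOnShift_coScaled {𝕊 : Finset (ℤ × ℤ × ℤ)} {cW c₀ ε₀ x : ℝ}
    {α : Fin m → Fin m → Fin m → ℤ × ℤ × ℤ → ℝ} {κ₂ : ℝ} {W₀ FW₀ BW₀ : Fin m → ℤ → ℝ}
    {W FW : Fin m → ℤ → ℝ → ℝ} (hW : PseudoFlowOnShift 𝕊 cW ε₀ α 0 κ₂ W₀ FW₀ BW₀ W FW)
    (hε : 0 ≤ 1 + ε₀) (hκ₂ : 0 ≤ κ₂) (hBW : ∀ i k, 0 ≤ BW₀ i k)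
    (hx : 0 < x) (hx1 : x ≤ 1) (hc₀ : 0 < c₀) (hc : c₀ ≤ cW) :
    PseudoFlowOnShift 𝕊 c₀ ε₀ α 0 κ₂ (fun i k => x * W₀ i k) (fun i k => x ^ 2 * FW₀ i k) BW₀
      (fun i k t => x * W i k (x * t)) (fun i k t => x ^ 2 * FW i k (x * t)) := by
  have hxc : x * c₀ ≤ cW := (mul_le_of_le_one_left hc₀.le hx1).trans hc
  have hsc := pseudoFlowOnShift_scale hW hx hc₀ hxc
  refine pseudoFlowOnShift_mono_defect hsc hε (by simp) (mul_le_of_le_one_left hκ₂ hx1) fun i k => ?_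
  calc x ^ 2 * BW₀ i k ≤ 1 * BW₀ i k :=
        mul_le_mul_of_nonneg_right (by nlinarith) (hBW i k)
    _ = BW₀ i k := one_mul _

/-- Sup bounds of the reference flow on `[0, c]` are inherited by the co-scaled reference (`0 ≤ x ≤ 1`).
[folklore (definitional); cell LADDER §64.8] -/
theorem abs_coScaled_le {W : Fin m → ℤ → ℝ → ℝ} {c x M : ℝ} {i : Fin m} {k : ℤ}
    (hM : ∀ s ∈ Icc (0 : ℝ) c, |W i k s| ≤ M) (hx : 0 ≤ x) (hx1 : x ≤ 1) :
    ∀ s ∈ Icc (0 : ℝ) c, |x * W i k (x * s)| ≤ M := by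
  intro s hs
  have hxs : x * s ∈ Icc (0 : ℝ) c :=
    ⟨mul_nonneg hx hs.1, (mul_le_of_le_one_left (hs.1.trans hs.2) hx1 |>.trans' (mul_le_mul_of_nonneg_left hs.2 hx))⟩
  have hb := hM (x * s) hxs
  have hM0 : 0 ≤ M := (abs_nonneg _).trans hb
  calc |x * W i k (x * s)| = x * |W i k (x * s)| := by rw [abs_mul, abs_of_nonneg hx]
    _ ≤ 1 * M := mul_le_mul hx1 hb (abs_nonneg _) zero_le_one
    _ = M := one_mul _

/-- With the reference started AT THE ANCHORED PULSE (`W₀ = u⋆` co-scaled by the anchor ratio `x`), the start mismatch of the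
interface/near/behind bookkeeping (`hE₁`, `hEW` of the hop step) vanishes identically. [folklore (definitional); cell LADDER §64.8] -/
theorem coScaled_start_sub_eq_zero (ustar : Fin m → ℤ → ℝ) (x : ℝ) (i : Fin m) (k : ℤ) :
    x * ustar i k - (fun j l => x * ustar j l) i k = 0 := sub_self _

end QuadPolar

end Summit.NavierStokesRegularity.NavierStokesRegularity.Theorems

end
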